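import Mathlib
import HarnessLib
import Literature.Computability.AlgebraicComplexity.TensorRestrictionRank
import Literature.Computability.AlgebraicComplexity.CoppersmithWinograd1990Proofs
import Summits.MatrixMultiplication.MatrixMultiplication.Theses.OutsiderSandwich

/-!
# OutsiderSandwich — the PACKING PROFILE: a strictly weaker, ω-free deciding crux
(decomp-mm lens 4 «minimal-counterexample / extremal reduction», gen 9)

The route `OutsiderSandwich` (`route-MatrixMultiplication-OutsiderSandwich`, rev 7) cuts `ω(ℂ) = 2`
into TOP = `CwTwoMMPerfect` (cofinally `⟨m,m,m⟩ ≤ cw₂^{⊠N}` with `m² ≥ 3^{(1-ε)N}`) and the residual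
law BOTTOM = `LaserMergeOptimal` (`⟨m,m,m⟩ ≤ cw₂^{⊠N} ⟹ m² ≤ 2^{(ℓ(ω)+ε)N}`,
`ℓ(ω) = 2/3 + (2/ω)(log₂3 − 2/3)`).  TOP asks for ONE matrix product of the full capacity `3^N`.

This generation replaces TOP, inside `closes`, by a STRICTLY WEAKER ω-free statement about PACKINGS
(direct sums `⟨B⟩ ⊗ ⟨m,m,m⟩` of equal matrix products):

  `PerfectBeyondLaser` (LNT):  `∃ γ > 0 ∀ ε > 0` cofinally in `N` some `⟨B⟩ ⊗ ⟨m,m,m⟩ ≤ cw₂^{⊠N}` has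
  PERFECT CAPACITY `B·m² ≥ 3^{(1-ε)N}` and block side `m ≥ 2^{(1/3+γ)N}`.

Calibration (all in kernel, this file + the lineage's `CwTwoMonomialFloor`):
* `perfectAtLaser` — the `γ = 0` endpoint IS A THEOREM: the laser zeroing of BCS Thm. 15.41 packs
  `cw₂^{⊠3k} ≥ ⟨p_k⟩ ⊗ ⟨2^k,2^k,2^k⟩` with `p_k·4^k ≥ 27^{(1-o(1))k}` — perfect capacity at block side
  EXACTLY `2^{N/3}`; and `2^{N/3}` is also exactly the lineage's monomial wall (`CwTwoMonomialFloor`,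
  item 29785: a support-monomial `⟨m,m,m⟩ ≤ cw₂^{⊠N}` has `m³ ≤ 2^N`), so every LNT witness is
  non-monomial;
* `perfectBeyondLaser_of_cwTwoMMPerfect` — TOP ⟹ LNT (`B = 1`, `γ = 1/12`): LNT is WEAKER than TOP;
  the converse («a perfect packing beyond the laser wall can be made a single perfect product») is the
  open THRESHOLD DICHOTOMY, so LNT is strictly weaker as far as anyone knows;
* `summit_of_perfectBeyondLaser` — LNT ∧ BOTTOM ⟹ `ω(ℂ) = 2`, by MERGING inside the packing: if
  `ω > 2`, replace `⟨B⟩` by `⟨a,a,a⟩` with `C_δ a^{ω+δ} ≤ B` (tree: `exists_tensorRank_matMulTensor_le_rpow`,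
  `tensorRestrictsTo_unitTensor_of_tensorRank_le`), obtaining the single product `⟨am,am,am⟩ ≤ cw₂^{⊠N}`
  of size `(am)² ≳ 3^{(1-ε)N}·B^{-(1-2/ω)} ≥ 2^{(ℓ(ω) + 2γ(1-2/ω) - o(1))N}` (because `B ≤ 3^N/m²`
  is exponentially SMALLER than at the laser point) — contradicting BOTTOM by the margin
  `2γ(1−2/ω) > 0`.  So `closes` can be re-glued to `closes (h₁ : PerfectBeyondLaser) (h₂ : LaserMergeOptimal)`
  (file `g9/glue.lean`, certified by `ledger route check --native --id … --closes-file`).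
The quantifier order `∃ γ ∀ ε` is load-bearing: `∀ ε ∃ γ` is trivially true (laser packing ⊗ a
`HalfMM` boost on `≈ 8εN` levels).

All statements are over the tree's `TensorRestrictsTo`, `kroneckerTensor`, `kroneckerPow`, `cwTensor`,
`unitTensor`, `matMulTensor`, `tensorRank`, `omega`; NO new definitions (the items are the route's
declarations, proved here by name).
Sources: BurgisserClausenShokrollahi1997 (Thm. 15.41 and its proof p. 381, §15.5 p. 425, (15.9)),
CoppersmithWinograd1990 (§6 «easy» algorithm, §7 coupling of two levels), Schonhage1981 (τ-theorem),
Blaser2013 (Lemma 5.4 p. 24, Thm. 7.5), Strassen1987 (relative exponents), AlmanVassilevskaWilliams2018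
(limits of the Galactic/Universal method on `cw_q`), ConnerGesmundoLandsbergVentura2022 (`R̲(cw₂)`, `Q̃(cw₂) = 3`).
-/

set_option linter.dupNamespace false

namespace Summit.MatrixMultiplication.MatrixMultiplication.Theorems.OutsiderSandwichPackingProfile

open scoped BigOperators
open Literature.Computability.AlgebraicComplexity
open Summit.MatrixMultiplication.MatrixMultiplication.Theses.OutsiderSandwich
  (CwTwoMMPerfect LaserMergeOptimal PerfectBeyondLaser PerfectAtLaser PerfectBeyondLaserOfMMPerfect
    SummitOfPerfectBeyondLaser)

/-! The four g9 items `PerfectBeyondLaser` (31793), `PerfectAtLaser` (31794),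
`PerfectBeyondLaserOfMMPerfect` (31795), `SummitOfPerfectBeyondLaser` (31796) are the ROUTE's
declarations (rev 8, commit 7067ef5f78e9; rev 9 394ded3434b9); this file proves
`SummitOfPerfectBeyondLaser` BY NAME (the re-glue LNT ∧ BOTTOM ⟹ ω = 2); the companion file
`OutsiderSandwichPackingProfileLaser.lean` proves `PerfectBeyondLaserOfMMPerfect` (TOP ⟹ LNT) and
`PerfectAtLaser` (the laser endpoint). -/


/-! ## Restriction plumbing -/

/-- `⟨a,a,a⟩ ⊗ ⟨m,m,m⟩ ≥ ⟨am,am,am⟩` (double-index relabelling).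
[cite: Blaser2013, Lemma 5.4 (p. 24)] -/
theorem matMul_kronecker_matMul_restrictsTo (a m : ℕ) :
    TensorRestrictsTo (kroneckerTensor (matMulTensor ℂ a a a) (matMulTensor ℂ m m m))
      (matMulTensor ℂ (a * m) (a * m) (a * m)) := by
  classical
  have e : kroneckerTensor (matMulTensor ℂ a a a) (matMulTensor ℂ m m m) =
      fun x y z => matMulTensor ℂ (a * m) (a * m) (a * m)
        (doubleIndexEquiv a a m m x) (doubleIndexEquiv a a m m y) (doubleIndexEquiv a a m m z) := by
    funext x y z
    exact kroneckerTensor_matMulTensor (K := ℂ) a a a m m m x y z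
  rw [e]
  exact tensorRestrictsTo_of_reindex (matMulTensor ℂ _ _ _) _ _ _

/-- `⟨m,m,m⟩ ≥ ⟨1⟩ ⊗ ⟨m,m,m⟩` (relabelling `Fin 1 × X ≃ X`). [cite: Blaser2013, §5.2 (p. 24)] -/
theorem matMul_restrictsTo_unitOne_kronecker (m : ℕ) :
    TensorRestrictsTo (matMulTensor ℂ m m m)
      (kroneckerTensor (unitTensor ℂ 1) (matMulTensor ℂ m m m)) := by
  classical
  set s := kroneckerTensor (unitTensor ℂ 1) (matMulTensor ℂ m m m) with hs
  have e : matMulTensor ℂ m m m = fun a b c =>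
      s ((Equiv.uniqueProd (Fin m × Fin m) (Fin 1)).symm a)
        ((Equiv.uniqueProd (Fin m × Fin m) (Fin 1)).symm b)
        ((Equiv.uniqueProd (Fin m × Fin m) (Fin 1)).symm c) := by
    funext a b c
    simp [hs, kroneckerTensor_apply]
  rw [e]
  exact tensorRestrictsTo_of_reindex s _ _ _

/-- **Merging inside a packing**: `cw₂^{⊠N} ≥ ⟨B⟩ ⊗ ⟨m,m,m⟩` and `R(⟨a,a,a⟩) ≤ B` give the single
product `cw₂^{⊠N} ≥ ⟨am,am,am⟩`. [cite: BurgisserClausenShokrollahi1997, §15.5 (p. 425)] -/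
theorem merge_restrictsTo {N B m a : ℕ}
    (h : TensorRestrictsTo (kroneckerPow (cwTensor ℂ 2) N)
      (kroneckerTensor (unitTensor ℂ B) (matMulTensor ℂ m m m)))
    (ha : tensorRank (matMulTensor ℂ a a a) ≤ B) :
    TensorRestrictsTo (kroneckerPow (cwTensor ℂ 2) N) (matMulTensor ℂ (a * m) (a * m) (a * m)) :=
  (h.trans ((tensorRestrictsTo_unitTensor_of_tensorRank_le _ ha).kronecker
    (TensorRestrictsTo.refl (matMulTensor ℂ m m m)))).trans (matMul_kronecker_matMul_restrictsTo a m)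

/-- **The merge factor**: for `δ > 0` there is `C > 0` such that every `B ≥ 1` admits `a ≥ 1` with
`R(⟨a,a,a⟩) ≤ B` and `2 log a ≥ (2/(ω+δ))(log B − log C) − 2 log 2` (`a = ⌊(B/C)^{1/(ω+δ)}⌋ ∨ 1`).
[cite: Blaser2013, Def. 5.1 and Thm. 5.2] -/
theorem exists_mergeFactor {δ : ℝ} (hδ : 0 < δ) :
    ∃ C : ℝ, 0 < C ∧ ∀ B : ℕ, 1 ≤ B → ∃ a : ℕ, 1 ≤ a ∧ tensorRank (matMulTensor ℂ a a a) ≤ B ∧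
      2 / (omega ℂ + δ) * (Real.log B - Real.log C) - 2 * Real.log 2 ≤ 2 * Real.log a := by
  obtain ⟨C, hC, hCb⟩ := exists_tensorRank_matMulTensor_le_rpow ℂ hδ
  have hω : 2 ≤ omega ℂ := omega_two_le ℂ
  have hωδ : 0 < omega ℂ + δ := by linarith
  refine ⟨C, hC, fun B hB => ?_⟩
  have hB0 : (0 : ℝ) < B := by exact_mod_cast hB
  obtain ⟨X, hX⟩ : ∃ X : ℝ, X = ((B : ℝ) / C) ^ (omega ℂ + δ)⁻¹ := ⟨_, rfl⟩
  have hBC : 0 < (B : ℝ) / C := div_pos hB0 hC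
  have hCne : C ≠ 0 := hC.ne'
  have hωδne : omega ℂ + δ ≠ 0 := hωδ.ne'
  have hX0 : 0 < X := hX ▸ Real.rpow_pos_of_pos hBC _
  have hlogX : Real.log X = (Real.log B - Real.log C) / (omega ℂ + δ) := by
    rw [hX, Real.log_rpow hBC, Real.log_div hB0.ne' hC.ne']; ring
  have hXpow : X ^ (omega ℂ + δ) = (B : ℝ) / C := by
    rw [hX]; exact Real.rpow_inv_rpow hBC.le hωδ.ne'
  have h2X : 2 / (omega ℂ + δ) * (Real.log B - Real.log C) = 2 * Real.log X := by
    rw [hlogX]; field_simp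
  by_cases h2 : 2 ≤ X
  · obtain ⟨a, ha⟩ : ∃ a : ℕ, a = ⌊X⌋₊ := ⟨_, rfl⟩
    have ha2 : 2 ≤ a := ha ▸ Nat.le_floor (by exact_mod_cast h2)
    have haX : (a : ℝ) ≤ X := ha ▸ Nat.floor_le hX0.le
    have haX' : X / 2 ≤ a := by
      have := Nat.lt_floor_add_one X; rw [← ha] at this; linarith
    have ha0 : (0 : ℝ) < a := by exact_mod_cast (by omega : 0 < a)
    refine ⟨a, by omega, ?_, ?_⟩
    · have h1 := hCb a (by omega)
      have h3 : (a : ℝ) ^ (omega ℂ + δ) ≤ X ^ (omega ℂ + δ) :=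
        Real.rpow_le_rpow ha0.le haX hωδ.le
      have h4 : (tensorRank (matMulTensor ℂ a a a) : ℝ) ≤ B := by
        calc (tensorRank (matMulTensor ℂ a a a) : ℝ) ≤ C * (a : ℝ) ^ (omega ℂ + δ) := h1
          _ ≤ C * X ^ (omega ℂ + δ) := mul_le_mul_of_nonneg_left h3 hC.le
          _ = B := by rw [hXpow]; field_simp
      exact_mod_cast h4
    · have hloga : Real.log X - Real.log 2 ≤ Real.log a := by
        have := Real.log_le_log (by positivity) haX'
        rwa [Real.log_div hX0.ne' (by norm_num)] at this
      linarith
  · have h2 : X < 2 := lt_of_not_ge h2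
    refine ⟨1, le_rfl, ?_, ?_⟩
    · calc tensorRank (matMulTensor ℂ 1 1 1) ≤ 1 * 1 * 1 := tensorRank_matMulTensor_le (K := ℂ) 1 1 1
        _ ≤ B := by omega
    · have hlogX2 : Real.log X < Real.log 2 := Real.log_lt_log hX0 h2
      simp only [Nat.cast_one, Real.log_one, mul_zero]
      linarith

/-! ## The re-glue: LNT ∧ BOTTOM ⟹ ω = 2 -/

/-- **LNT ∧ BOTTOM ⟹ `ω(ℂ) = 2`.**  If `ω > 2`, merging inside an LNT packing produces single
products beyond the laser-merge rate `2^{ℓ(ω)}` by the margin `2γ(1 − 2/ω)`, contradicting BOTTOM.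
[cite: BurgisserClausenShokrollahi1997, §15.5 (p. 425); CoppersmithWinograd1990, §6] -/
theorem summit_of_perfectBeyondLaser (h₁ : PerfectBeyondLaser) (h₂ : LaserMergeOptimal) :
    _root_.MatrixMultiplication := by
  have hω : 2 ≤ omega ℂ := omega_two_le ℂ
  rw [_root_.MatrixMultiplication_iff]
  by_contra hne
  have hω2 : 2 < omega ℂ := lt_of_le_of_ne hω (fun h => hne h.symm)
  obtain ⟨ω, hωdef⟩ : ∃ w : ℝ, w = omega ℂ := ⟨_, rfl⟩
  rw [← hωdef] at hω hω2
  obtain ⟨γ, hγ, hP⟩ := h₁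
  -- constants
  have hlog2 : 0 < Real.log 2 := Real.log_pos one_lt_two
  have hlog2' : Real.log 2 ≤ 1 := by
    rw [Real.log_le_iff_le_exp (by norm_num)]; linarith [Real.add_one_le_exp (1 : ℝ)]
  have hlog3 : 0 < Real.log 3 := Real.log_pos (by norm_num)
  have hlog3' : Real.log 3 ≤ 2 := by
    rw [Real.log_le_iff_le_exp (by norm_num)]; linarith [Real.add_one_le_exp (2 : ℝ)]
  have hω0 : 0 < ω := by linarith
  -- `u = 2/ω < 1` and the margin `G = 2γ(1-u) log 2`
  obtain ⟨u, hu⟩ : ∃ u : ℝ, u = 2 / ω := ⟨_, rfl⟩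
  have hu0 : 0 < u := hu ▸ div_pos two_pos hω0
  have hu1 : u < 1 := by rw [hu, div_lt_one hω0]; exact hω2
  obtain ⟨G, hG⟩ : ∃ G : ℝ, G = 2 * γ * (1 - u) * Real.log 2 := ⟨_, rfl⟩
  have hG0 : 0 < G := by rw [hG]; exact mul_pos (mul_pos (by positivity) (by linarith)) hlog2
  -- parameters `δ = G/4`, `ε = G/8`
  obtain ⟨δ, hδ⟩ : ∃ δ : ℝ, δ = G / 4 := ⟨_, rfl⟩
  have hδ0 : 0 < δ := by rw [hδ]; positivity
  obtain ⟨ε, hε⟩ : ∃ ε : ℝ, ε = G / 8 := ⟨_, rfl⟩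
  have hε0 : 0 < ε := by rw [hε]; positivity
  obtain ⟨C, hC, hmf⟩ := exists_mergeFactor (δ := δ) hδ0
  rw [← hωdef] at hmf
  obtain ⟨v, hv⟩ : ∃ v : ℝ, v = 2 / (ω + δ) := ⟨_, rfl⟩
  have hωδ : 0 < ω + δ := by linarith
  have hv0 : 0 < v := hv ▸ div_pos two_pos hωδ
  have hvu : v ≤ u := by
    rw [hu, hv]; exact div_le_div_of_nonneg_left (by norm_num) hω0 (by linarith)
  have hv1 : v ≤ 1 := by linarith
  have huv : u - v ≤ δ / 2 := by
    have e1 : u - v = 2 * δ / (ω * (ω + δ)) := by rw [hu, hv]; field_simp; ring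
    have h4 : 4 ≤ ω * (ω + δ) := by nlinarith
    rw [e1, div_le_iff₀ (by positivity)]
    nlinarith
  -- BOTTOM threshold and the witness level
  obtain ⟨N₁, hN₁⟩ := h₂ ε hε0
  rw [← hωdef] at hN₁
  obtain ⟨K, hK⟩ : ∃ K : ℝ, K = |Real.log C| + 2 * Real.log 2 := ⟨_, rfl⟩
  obtain ⟨N, hN, B, m, hres, hcap, hm⟩ := hP ε hε0 (max N₁ (⌈K / (3 * G / 8)⌉₊ + 1))
  have hNN₁ : N₁ ≤ N := (le_max_left _ _).trans hN
  have hNK : K < 3 * G / 8 * N := by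
    have h1 : ⌈K / (3 * G / 8)⌉₊ + 1 ≤ N := (le_max_right _ _).trans hN
    have h2 : K / (3 * G / 8) < N := by
      calc K / (3 * G / 8) ≤ ⌈K / (3 * G / 8)⌉₊ := Nat.le_ceil _
        _ < N := by exact_mod_cast (by omega : ⌈K / (3 * G / 8)⌉₊ < N)
    rw [div_lt_iff₀ (by positivity)] at h2
    linarith
  have hn0 : (0 : ℝ) ≤ N := Nat.cast_nonneg N
  -- `m ≥ 1`, `B ≥ 1`
  have hm0 : (0 : ℝ) < m := lt_of_lt_of_le (Real.rpow_pos_of_pos two_pos _) hm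
  have hB1 : 1 ≤ B := by
    by_contra hB
    have hB' : B = 0 := by omega
    rw [hB', Nat.cast_zero, zero_mul] at hcap
    linarith [Real.rpow_pos_of_pos (show (0 : ℝ) < 3 by norm_num) ((1 - ε) * N)]
  have hB0 : (0 : ℝ) < B := by exact_mod_cast hB1
  -- merge
  obtain ⟨a, ha1, haR, hloga⟩ := hmf B hB1
  rw [← hv] at hloga
  have ha0 : (0 : ℝ) < a := by exact_mod_cast ha1
  have hup := hN₁ N hNN₁ (a * m) (merge_restrictsTo hres haR)
  -- logarithms
  have hL1 : (1 - ε) * N * Real.log 3 ≤ Real.log B + 2 * Real.log m := by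
    have := Real.log_le_log (by positivity) hcap
    rwa [Real.log_rpow (by norm_num), Real.log_mul hB0.ne' (by positivity), Real.log_pow] at this
  have hL2 : (1 / 3 + γ) * N * Real.log 2 ≤ Real.log m := by
    have := Real.log_le_log (by positivity) hm
    rwa [Real.log_rpow (by norm_num)] at this
  have hL3 : 2 * Real.log a + 2 * Real.log m ≤
      2 / 3 * N * Real.log 2 + u * N * Real.log 3 - 2 / 3 * u * N * Real.log 2 +
        ε * N * Real.log 2 := by
    have ham : (0 : ℝ) < ((a * m : ℕ) : ℝ) := by push_cast; exact mul_pos ha0 hm0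
    have h := Real.log_le_log (pow_pos ham 2) hup
    have lhs : Real.log (((a * m : ℕ) : ℝ) ^ 2) = 2 * Real.log a + 2 * Real.log m := by
      rw [Real.log_pow]; push_cast; rw [Real.log_mul ha0.ne' hm0.ne']; ring
    have hlog2ne : Real.log 2 ≠ 0 := hlog2.ne'
    have rhs : Real.log ((2 : ℝ) ^ ((2 / 3 + 2 / ω * (Real.logb 2 3 - 2 / 3) + ε) * (N : ℝ))) =
        2 / 3 * N * Real.log 2 + u * N * Real.log 3 - 2 / 3 * u * N * Real.log 2 +
          ε * N * Real.log 2 := by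
      rw [Real.log_rpow two_pos, ← hu, Real.logb]; field_simp; ring
    rw [lhs, rhs] at h
    exact h
  -- auxiliary product bounds
  have hL1v : v * ((1 - ε) * N * Real.log 3) ≤ v * (Real.log B + 2 * Real.log m) :=
    mul_le_mul_of_nonneg_left hL1 hv0.le
  have hL2v : (1 - v) * ((1 / 3 + γ) * N * Real.log 2) ≤ (1 - v) * Real.log m :=
    mul_le_mul_of_nonneg_left hL2 (by linarith)
  have huv0 : 0 ≤ u - v := by linarith
  have hA : (u - v) * N * Real.log 3 ≤ δ * N := by
    have h1 : (u - v) * Real.log 3 ≤ δ := by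
      calc (u - v) * Real.log 3 ≤ (u - v) * 2 := mul_le_mul_of_nonneg_left hlog3' huv0
        _ ≤ δ := by linarith
    have := mul_le_mul_of_nonneg_right h1 hn0
    linarith
  have hBB : 0 ≤ (u - v) * N * Real.log 2 := mul_nonneg (mul_nonneg huv0 hn0) hlog2.le
  have hCC : 0 ≤ γ * ((u - v) * N * Real.log 2) := mul_nonneg hγ.le hBB
  have hD : v * ε * N * Real.log 3 ≤ 2 * ε * N := by
    have h1 : v * Real.log 3 ≤ 1 * 2 := mul_le_mul hv1 hlog3' hlog3.le zero_le_one
    have := mul_le_mul_of_nonneg_left h1 (mul_nonneg hε0.le hn0)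
    linarith
  have hE : ε * N * Real.log 2 ≤ ε * N := by
    have := mul_le_mul_of_nonneg_left hlog2' (mul_nonneg hε0.le hn0)
    linarith
  have hF : v * Real.log C ≤ |Real.log C| := by
    have h1 : v * Real.log C ≤ v * |Real.log C| := mul_le_mul_of_nonneg_left (le_abs_self _) hv0.le
    have h2 : v * |Real.log C| ≤ 1 * |Real.log C| :=
      mul_le_mul_of_nonneg_right hv1 (abs_nonneg _)
    linarith
  have hGn : G * N = 2 * γ * N * Real.log 2 - 2 * γ * u * N * Real.log 2 := by rw [hG]; ring
  have hδn : δ * N = G / 4 * N := by rw [hδ]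
  have hεn : ε * N = G / 8 * N := by rw [hε]
  -- the contradiction
  linarith [hL1v, hL2v, hL3, hloga, hA, hBB, hCC, hD, hE, hF, hGn, hδn, hεn, hNK, hK]

/-! ## The route item, by name (rev 9) -/

/-- **Item `OutsiderSandwich.SummitOfPerfectBeyondLaser` (stmt-MatrixMultiplication-31796) holds**:
`PerfectBeyondLaser → LaserMergeOptimal → ω(ℂ) = 2`. [this route, g9] -/
theorem summitOfPerfectBeyondLaser_holds : SummitOfPerfectBeyondLaser :=
  summit_of_perfectBeyondLaser

end Summit.MatrixMultiplication.MatrixMultiplication.Theorems.OutsiderSandwichPackingProfile
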